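/-
Copyright (c) 2026 the pub-hodgecm-mathlib formalisation cell (harness21).  Prover seat hodgecm-mathlib-A-p03 (g30), P6 «MOD programme»,
organ (ν8d) «ISOMORPHISMS REDUCE TO ISOMORPHISMS» (D-line `stub_FROB` road A, census v2 §3); 2026-09-02.
-/
import Literature.AlgebraicGeometry.AbelianSchemes.AbelianSchemeHomReductionSpecialFibre
import Literature.AlgebraicGeometry.AbelianSchemes.IsogenyOfGenericIsogenyRank
import Literature.AlgebraicGeometry.AbelianSchemes.AbelianSchemeHomDescentFlatSurjective
import Literature.AlgebraicGeometry.AbelianSchemes.DualIsogenyDegree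
import HarnessLib

/-!
# REDUCTION OF AN ISOMORPHISM BETWEEN FIBRE TUPLES AT TWO `Ω`-POINTS IS AN ISOMORPHISM
# ([SerreTate1968] §1; [BoschLutkebohmertRaynaud1990] §7.3 Prop. 6: the degree of a generic isogeny is constant along the base)

Topic `AlgebraicGeometry/AbelianSchemes`, namespace `Literature.AlgebraicGeometry.AbelianSchemes.AbelianSchemeOver`.  THEOREMS ONLY.  Cell `hodgecm-mathlib`
(D-0151), F0∕P6 «MOD», organ **(ν8d)** completing ★ (ν8) `AbelianSchemeHomReductionSpecialFibre`: in the two-stage setting of ★ (ν8) §1 with the stage the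
spectrum of a DEDEKIND domain `R`, if the generic hom `u` is an ISOMORPHISM then so is the special one `ū := E_𝒜 ≫ U_{b′} ≫ E_𝒞⁻¹`: `deg U_t` is the same at
every field point `t` of `Spec R` (★ `kerRank_fibreHom_eq_kerRank_genericFibre`), it is `deg u = 1` at `a′`, and an isogeny of degree `1` is an isomorphism
(★ `isIso_of_comp_eq_of_finrank_eq`).  HEAD `exists_specialFibre_iso_reduction`: ★ (ν7)'s turnkey re-run with this clause — for an isomorphism `u` of the generic
fibre tuples there is an ISOMORPHISM `ū` of the special fibre tuples with the transfers (ii) equivariance, (iii) section values, (iv) polarisation law of ★ (ν8).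
Consumer: the D-line `stub_FROB` road A (census v2 §3: the Frobenius cover is the family Serre cover composed with the reduction of the upstairs KER-EQ
isomorphism and the Frobenius-twist isomorphism) and `stub_ROOF0` (r-B).

HONEST LABEL: HC_CM is proved only modulo the cell's 2 remaining named inputs (hLiu418 24832, h413 24833) until rung 0 closes; generic capital on
`--supports stmt-HodgeConjecture-24832`, pays no letter.

## References
* [SerreTate1968] J.-P. Serre, J. Tate, *Good reduction of abelian varieties*, Ann. of Math. 88 (1968), §1.
* [BoschLutkebohmertRaynaud1990] S. Bosch, W. Lütkebohmert, M. Raynaud, *Néron Models* (1990), §1.2 Prop. 8, §7.3 Prop. 6 (p. 180).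
* [GortzWedhorn2023] U. Görtz, T. Wedhorn, *Algebraic Geometry II* (2023), Cor. 27.177.
* [MumfordAV1970] D. Mumford, *Abelian Varieties* (1970), §7 Thm. 4 (p. 72).
-/

set_option autoImplicit false

noncomputable section

set_option backward.isDefEq.respectTransparency false

open CategoryTheory CategoryTheory.Limits AlgebraicGeometry
open scoped MonObj CategoryTheory.Obj NumberField
open Literature.AlgebraicGeometry.Motives
open IsDedekindDomain IsDedekindDomain.HeightOneSpectrum ValuativeRel
open Literature.NumberTheory.EllipticCurves (genericFibre specGenericPoint)
open Literature.NumberTheory.GaloisRepresentations (closureValuationSubring)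
open Literature.NumberTheory.DiophantineGeometry

namespace Literature.AlgebraicGeometry.AbelianSchemes

namespace AbelianSchemeOver

universe u

section Bookkeeping

/-- Composition of morphisms of abelian varieties, read on the underlying group-scheme morphisms. [folklore] -/
private theorem av_comp_hom₃ {k : Type u} [Field k] {X Y Z : AbelianVariety k} (φ : X ⟶ Y) (ψ : Y ⟶ Z) :
    (φ ≫ ψ).hom.hom.hom = φ.hom.hom.hom ≫ ψ.hom.hom.hom := rfl

/-- A morphism of abelian varieties whose underlying scheme morphism is an isomorphism is an isogeny of degree `1`. [cite: GortzWedhorn2023, Cor. 27.177] -/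
private theorem isIsogeny_and_kerRank_of_isIso_toSchemeHom {k : Type u} [Field k] {X Y : AbelianVariety k} (φ : X ⟶ Y)
    [IsIso (AbelianVariety.Hom.toSchemeHom φ)] : AbelianVariety.IsIsogeny φ ∧ AbelianVariety.Hom.kerRank φ = 1 := by
  have hI : AbelianVariety.IsIsogeny φ := ⟨inferInstance, inferInstance⟩
  refine ⟨hI, ?_⟩
  rw [← hI.finrank_eq_kerRank (genericPoint Y.X.left)]
  exact congrFun (Scheme.Hom.finrank_eq_one_of_isIso (AbelianVariety.Hom.toSchemeHom φ)) _

/-- An isomorphism of abelian varieties is an isogeny of degree `1`. [cite: GortzWedhorn2023, Cor. 27.177] -/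
private theorem isIsogeny_and_kerRank_hom_of_iso {k : Type u} [Field k] {X Y : AbelianVariety k} (φ : X ≅ Y) :
    AbelianVariety.IsIsogeny φ.hom ∧ AbelianVariety.Hom.kerRank φ.hom = 1 := by
  haveI : IsIso (AbelianVariety.Hom.toSchemeHom φ.hom) :=
    ⟨AbelianVariety.Hom.toSchemeHom φ.inv,
      by change AbelianVariety.Hom.toSchemeHom (φ.hom ≫ φ.inv) = _; rw [φ.hom_inv_id]; rfl,
      by change AbelianVariety.Hom.toSchemeHom (φ.inv ≫ φ.hom) = _; rw [φ.inv_hom_id]; rfl⟩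
  exact isIsogeny_and_kerRank_of_isIso_toSchemeHom φ.hom

end Bookkeeping

section Abstract

/-! ### §1 The abstract two-stage setting over a Dedekind stage: `deg U_{b′} = deg U_{a′} = deg u` -/

variable {T Ug V Us : Scheme.{u}} {R : Type u} [CommRing R] [IsDedekindDomain R] (K : Type u) [Field K] [Algebra R K] [IsFractionRing R K]
  {Ω κ : Type u} [Field Ω] [Field κ]
  (j : Ug ⟶ T) (z z'' : V ⟶ T) (g : Spec (.of R) ⟶ V) (y y'' : Spec (.of Ω) ⟶ Ug) (a : Spec (.of Ω) ⟶ V) (a' : Spec (.of Ω) ⟶ Spec (.of R))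
  (hpt : y ≫ j = a ≫ z) (hpt'' : y'' ≫ j = a ≫ z'') (e : a' ≫ g = a)
  (js : Us ⟶ T) (ys ys'' : Spec (.of κ) ⟶ Us) (b : Spec (.of κ) ⟶ V) (b' : Spec (.of κ) ⟶ Spec (.of R))
  (hspt : ys ≫ js = b ≫ z) (hspt'' : ys'' ≫ js = b ≫ z'') (es : b' ≫ g = b)
  (𝒜 𝒞 : AbelianSchemeOver T)
  (U : ((𝒜.baseChange z).baseChange g).X ⟶ ((𝒞.baseChange z'').baseChange g).X) [IsMonHom U]
  (u : ((𝒜.baseChange j).baseChange y).X ⟶ ((𝒞.baseChange j).baseChange y'').X) [IsMonHom u]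
  (hfib : fibreHom U a' =
    (𝒜.fibreBaseChangeIso j y ≪≫ 𝒜.fibreCongrPtIso hpt ≪≫ (𝒜.fibreBaseChangeIso z a).symm ≪≫ ((𝒜.baseChange z).fibreCongrPtIso e).symm ≪≫ ((𝒜.baseChange z).fibreBaseChangeIso g a').symm).inv ≫ homOfIsMonHom u ≫
      (𝒞.fibreBaseChangeIso j y'' ≪≫ 𝒞.fibreCongrPtIso hpt'' ≪≫ (𝒞.fibreBaseChangeIso z'' a).symm ≪≫ ((𝒞.baseChange z'').fibreCongrPtIso e).symm ≪≫ ((𝒞.baseChange z'').fibreBaseChangeIso g a').symm).hom)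
  (hUgen : AbelianVariety.IsIsogeny (fibreHom U (specGenericPoint R K)))

include K hfib hUgen in
/-- **AN ISOMORPHISM REDUCES TO AN ISOMORPHISM** (two-stage setting over a Dedekind stage `Spec R`): if `u` is an isomorphism then so is
`ū := E_𝒜 ≫ U_{b′} ≫ E_𝒞⁻¹` — `deg U_{b′} = deg U_{a′}` (★ `kerRank_fibreHom_eq_kerRank_genericFibre`, both equal to the generic degree), `deg U_{a′} = deg u = 1`
(`U_{a′} = E_𝒜⁻¹ ≫ u ≫ E_𝒞`, degrees multiply), and an isogeny of degree `1` is an isomorphism (★ `isIso_of_comp_eq_of_finrank_eq` against the identity).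
[cite: BoschLutkebohmertRaynaud1990, §7.3 Prop. 6 (p. 180)] [cite: GortzWedhorn2023, Cor. 27.177] [cite: MumfordAV1970, §7 Thm. 4 (p. 72)] -/
theorem isIso_specialFibre_of_isIso [IsIso u] :
    IsIso ((𝒜.fibreBaseChangeIso js ys ≪≫ 𝒜.fibreCongrPtIso hspt ≪≫ (𝒜.fibreBaseChangeIso z b).symm ≪≫ ((𝒜.baseChange z).fibreCongrPtIso es).symm ≪≫ ((𝒜.baseChange z).fibreBaseChangeIso g b').symm).hom ≫ fibreHom U b' ≫ (𝒞.fibreBaseChangeIso js ys'' ≪≫ 𝒞.fibreCongrPtIso hspt'' ≪≫ (𝒞.fibreBaseChangeIso z'' b).symm ≪≫ ((𝒞.baseChange z'').fibreCongrPtIso es).symm ≪≫ ((𝒞.baseChange z'').fibreBaseChangeIso g b').symm).inv).hom.hom.hom := by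
  -- `u` is an isogeny of degree 1
  haveI : IsIso (AbelianVariety.Hom.toSchemeHom (homOfIsMonHom u)) := inferInstanceAs (IsIso ((Over.forget _).map u))
  have hu1 := isIsogeny_and_kerRank_of_isIso_toSchemeHom (homOfIsMonHom u)
  have hEA := isIsogeny_and_kerRank_hom_of_iso (𝒜.fibreBaseChangeIso j y ≪≫ 𝒜.fibreCongrPtIso hpt ≪≫ (𝒜.fibreBaseChangeIso z a).symm ≪≫ ((𝒜.baseChange z).fibreCongrPtIso e).symm ≪≫ ((𝒜.baseChange z).fibreBaseChangeIso g a').symm).symm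
  have hEC := isIsogeny_and_kerRank_hom_of_iso (𝒞.fibreBaseChangeIso j y'' ≪≫ 𝒞.fibreCongrPtIso hpt'' ≪≫ (𝒞.fibreBaseChangeIso z'' a).symm ≪≫ ((𝒞.baseChange z'').fibreCongrPtIso e).symm ≪≫ ((𝒞.baseChange z'').fibreBaseChangeIso g a').symm)
  -- `deg U_{a′} = 1`
  have hgen1 : AbelianVariety.Hom.kerRank (fibreHom U a') = 1 := by
    rw [hfib]
    change AbelianVariety.Hom.kerRank ((𝒜.fibreBaseChangeIso j y ≪≫ 𝒜.fibreCongrPtIso hpt ≪≫ (𝒜.fibreBaseChangeIso z a).symm ≪≫ ((𝒜.baseChange z).fibreCongrPtIso e).symm ≪≫ ((𝒜.baseChange z).fibreBaseChangeIso g a').symm).symm.hom ≫ homOfIsMonHom u ≫ (𝒞.fibreBaseChangeIso j y'' ≪≫ 𝒞.fibreCongrPtIso hpt'' ≪≫ (𝒞.fibreBaseChangeIso z'' a).symm ≪≫ ((𝒞.baseChange z'').fibreCongrPtIso e).symm ≪≫ ((𝒞.baseChange z'').fibreBaseChangeIso g a').symm).hom) = 1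
    rw [hEA.1.kerRank_comp_comp hu1.1 hEC.1, hEA.2, hu1.2, hEC.2]
  -- `deg U_{b′} = 1`
  have hb1 : AbelianVariety.Hom.kerRank (fibreHom U b') = 1 := by
    rw [kerRank_fibreHom_eq_kerRank_genericFibre K U hUgen b', ← kerRank_fibreHom_eq_kerRank_genericFibre K U hUgen a', hgen1]
  -- `U_{b′}` is an isogeny of degree `1`, hence an isomorphism of group schemes
  have hUb : AbelianVariety.IsIsogeny (fibreHom U b') := isIsogeny_fibreHom_of_isIsogeny_genericFibre K U hUgen b'
  haveI := (fibreHom U b').hom.hom.isMonHom_hom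
  haveI : IsFinite (fibreHom U b').hom.hom.hom.left := hUb.2
  haveI : Flat (fibreHom U b').hom.hom.hom.left := hUb.flat
  haveI : IsFinite (CommaMorphism.left (𝟙 (((𝒜.baseChange z).baseChange g).baseChange b').X)) := by
    change IsFinite (𝟙 (((𝒜.baseChange z).baseChange g).baseChange b').X.left); infer_instance
  haveI : Flat (CommaMorphism.left (𝟙 (((𝒜.baseChange z).baseChange g).baseChange b').X)) := by
    change Flat (𝟙 (((𝒜.baseChange z).baseChange g).baseChange b').X.left); infer_instance
  haveI : Surjective (CommaMorphism.left (𝟙 (((𝒜.baseChange z).baseChange g).baseChange b').X)) := by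
    change Surjective (𝟙 (((𝒜.baseChange z).baseChange g).baseChange b').X.left); infer_instance
  haveI hIsoUb : IsIso (fibreHom U b').hom.hom.hom :=
    isIso_of_comp_eq_of_finrank_eq (((𝒜.baseChange z).baseChange g).baseChange b') (𝟙 _) (fibreHom U b').hom.hom.hom
      (Category.id_comp _) 1
      (fun c => congrFun (Scheme.Hom.finrank_eq_one_of_isIso (𝟙 (((𝒜.baseChange z).baseChange g).baseChange b').X.left)) c)
      (fun x => (hUb.finrank_eq_kerRank x).trans hb1)
  -- conjugate by the special five-piece isomorphisms
  rw [av_comp_hom₃, av_comp_hom₃]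
  haveI : IsIso (𝒜.fibreBaseChangeIso js ys ≪≫ 𝒜.fibreCongrPtIso hspt ≪≫ (𝒜.fibreBaseChangeIso z b).symm ≪≫ ((𝒜.baseChange z).fibreCongrPtIso es).symm ≪≫ ((𝒜.baseChange z).fibreBaseChangeIso g b').symm).hom.hom.hom.hom :=
    ⟨(𝒜.fibreBaseChangeIso js ys ≪≫ 𝒜.fibreCongrPtIso hspt ≪≫ (𝒜.fibreBaseChangeIso z b).symm ≪≫ ((𝒜.baseChange z).fibreCongrPtIso es).symm ≪≫ ((𝒜.baseChange z).fibreBaseChangeIso g b').symm).inv.hom.hom.hom, AbelianVariety.iso_hom_hom_hom_hom_comp_inv _, AbelianVariety.iso_inv_hom_hom_hom_comp_hom _⟩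
  haveI : IsIso (𝒞.fibreBaseChangeIso js ys'' ≪≫ 𝒞.fibreCongrPtIso hspt'' ≪≫ (𝒞.fibreBaseChangeIso z'' b).symm ≪≫ ((𝒞.baseChange z'').fibreCongrPtIso es).symm ≪≫ ((𝒞.baseChange z'').fibreBaseChangeIso g b').symm).inv.hom.hom.hom :=
    ⟨(𝒞.fibreBaseChangeIso js ys'' ≪≫ 𝒞.fibreCongrPtIso hspt'' ≪≫ (𝒞.fibreBaseChangeIso z'' b).symm ≪≫ ((𝒞.baseChange z'').fibreCongrPtIso es).symm ≪≫ ((𝒞.baseChange z'').fibreBaseChangeIso g b').symm).hom.hom.hom.hom, AbelianVariety.iso_inv_hom_hom_hom_comp_hom _, AbelianVariety.iso_hom_hom_hom_hom_comp_inv _⟩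
  infer_instance

end Abstract

section Head

variable {K : Type} [Field K] [NumberField K] {v : HeightOneSpectrum (𝓞 K)} {Y : SchemeOver K}
  (𝓨 : IntegralModel (valuationSubringAtPrime K v) K Y) [IsProper 𝓨.total.hom]
  (𝒜 𝒞 : AbelianSchemeOver 𝓨.total.left) (x x'' : AlgPoints Y (AlgebraicClosure (v.adicCompletion K)))

set_option maxHeartbeats 400000 in
/-- **THE SPECIAL FIBRE OF THE REDUCTION OF AN ISOMORPHISM BETWEEN FIBRE TUPLES IS AN ISOMORPHISM, WITH ITS TRANSFERS.**  As ★ (ν8)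
`exists_specialFibre_hom_reduction`, for `u` an ISOMORPHISM of the generic fibre tuples (`IsIso u`): there is an ISOMORPHISM `ū : (𝒜_s)_{x̄} ⟶ (𝒞_s)_{x̄″}` of group schemes
(`IsMonHom ū`, `IsIso ū`) with (ii) equivariance for endomorphism pairs, (iii) identities of section values, (iv) polarisation laws in dual-homomorphism form transferring
from `u` to `ū` (§1 `isIso_specialFibre_of_isIso` + the three transfers of ★ (ν8) §1, on ★ (ν7)'s turnkey). [cite: SerreTate1968, §1]
[cite: BoschLutkebohmertRaynaud1990, §1.2 Prop. 8 and §7.3 Prop. 6 (p. 180)] [cite: MumfordFogartyKirwan1994, Ch. 6 §1 Corollary 6.2 (p. 116); Ch. 7 §2 Definition 7.2 (p. 129)] -/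
theorem exists_specialFibre_iso_reduction
    (u : ((𝒜.baseChange (𝓨.genericIso'.inv.left ≫ pullback.fst 𝓨.total.hom (specGenericPoint (valuationSubringAtPrime K v) K))).baseChange x.left).X ⟶
         ((𝒞.baseChange (𝓨.genericIso'.inv.left ≫ pullback.fst 𝓨.total.hom (specGenericPoint (valuationSubringAtPrime K v) K))).baseChange x''.left).X)
    [IsMonHom u] [IsIso u] :
    ∃ (ubar : ((𝒜.baseChange (pullback.fst 𝓨.total.hom (specResidueField v))).baseChange (𝓨.geomReductionMap x).left).X ⟶
               ((𝒞.baseChange (pullback.fst 𝓨.total.hom (specResidueField v))).baseChange (𝓨.geomReductionMap x'').left).X) (_ : IsMonHom ubar) (_ : IsIso ubar),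
      -- (ii) equivariance for endomorphism pairs transfers
      (∀ (f : 𝒜.X ⟶ 𝒜.X) (g : 𝒞.X ⟶ 𝒞.X) [IsMonHom f] [IsMonHom g],
        baseChangeHom (baseChangeHom f _) x.left ≫ u = u ≫ baseChangeHom (baseChangeHom g _) x''.left →
        baseChangeHom (baseChangeHom f (pullback.fst 𝓨.total.hom (specResidueField v))) (𝓨.geomReductionMap x).left ≫ ubar =
          ubar ≫ baseChangeHom (baseChangeHom g (pullback.fst 𝓨.total.hom (specResidueField v))) (𝓨.geomReductionMap x'').left) ∧
      -- (iii) identities of section values transfer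
      (∀ (τ : 𝒜.Sections) (τ'' : 𝒞.Sections),
        AlgPoints.map u ((𝒜.baseChange _).restrictPt x.left (𝒜.sectionBaseChange _ τ)) =
          (𝒞.baseChange _).restrictPt x''.left (𝒞.sectionBaseChange _ τ'') →
        AlgPoints.map ubar ((𝒜.baseChange (pullback.fst 𝓨.total.hom (specResidueField v))).restrictPt (𝓨.geomReductionMap x).left
            (𝒜.sectionBaseChange _ τ)) =
          (𝒞.baseChange (pullback.fst 𝓨.total.hom (specResidueField v))).restrictPt (𝓨.geomReductionMap x'').left (𝒞.sectionBaseChange _ τ'')) ∧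
      -- (iv) a polarisation law in dual-homomorphism form transfers
      (∀ (D𝒜 : 𝒜.DualPair) (pol𝒜 : 𝒜.Polarization D𝒜) (D𝒞 : 𝒞.DualPair) (pol𝒞 : 𝒞.Polarization D𝒞) (n : ℕ),
        u ≫ ((pol𝒞.baseChange _).baseChange x''.left).lam ≫ DualPair.dualIsogenyOver u ((D𝒜.baseChange _).baseChange x.left) ((D𝒞.baseChange _).baseChange x''.left) =
          ((pol𝒜.baseChange _).baseChange x.left).lam ≫ ((D𝒜.baseChange _).baseChange x.left).hat.mulN n →
        ubar ≫ ((pol𝒞.baseChange (pullback.fst 𝓨.total.hom (specResidueField v))).baseChange (𝓨.geomReductionMap x'').left).lam ≫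
            DualPair.dualIsogenyOver ubar ((D𝒜.baseChange (pullback.fst 𝓨.total.hom (specResidueField v))).baseChange (𝓨.geomReductionMap x).left)
              ((D𝒞.baseChange (pullback.fst 𝓨.total.hom (specResidueField v))).baseChange (𝓨.geomReductionMap x'').left) =
          ((pol𝒜.baseChange (pullback.fst 𝓨.total.hom (specResidueField v))).baseChange (𝓨.geomReductionMap x).left).lam ≫
            ((D𝒜.baseChange (pullback.fst 𝓨.total.hom (specResidueField v))).baseChange (𝓨.geomReductionMap x).left).hat.mulN n) := by
  -- the homomorphism of abelian varieties underlying `u`, and the TURNKEY reduction ★ (ν7)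
  obtain ⟨D, _i1, _i2, L, _i3, _i4, _i5, _i6, _i7, _i8, gD, h, hh, hgD, ha, z, z'', hz, hz'', L', _j1, _j2, _j3, _j4, _j5, χ, h', U, hU,
      hpt, hpt'', e, hspt, hspt'', et, hχ, hh', hh'h, hDed, hFrac, hfib, huniq, hisog⟩ :=
    exists_stage_hom_reduction_turnkey 𝓨 𝒜 𝒞 x x'' (homOfIsMonHom u)
  haveI := hDed
  haveI := hFrac
  haveI := hU
  -- injectivity of restriction to the `Ω`-point `ξ′` of the refined stage (schematically dominant: `D′ → Ω` injective)
  have h'inj : Function.Injective h' := by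
    intro a b hab
    have h1 : χ (a : L') = χ (b : L') := by rw [← hh', ← hh', hab]
    exact Subtype.ext (hχ h1)
  haveI : IsDominant (specGenericPoint (closureValuationSubring (v.adicCompletion K)) (AlgebraicClosure (v.adicCompletion K)) ≫ Spec.map (CommRingCat.ofHom h')) := by
    haveI := isDominant_specMap_of_injective
      (algebraMap (closureValuationSubring (v.adicCompletion K)) (AlgebraicClosure (v.adicCompletion K))) Subtype.val_injective
    haveI := isDominant_specMap_of_injective h' h'inj
    infer_instance
  haveI : IsSchemeTheoreticallyDominant (specGenericPoint (closureValuationSubring (v.adicCompletion K)) (AlgebraicClosure (v.adicCompletion K)) ≫ Spec.map (CommRingCat.ofHom h')) := IsSchemeTheoreticallyDominant.of_isDominant _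
  -- the special fibre of `U`, transported along the special five-piece along-stage isomorphisms (★ (ν6) §1 shape at `j := ι_s`, `y := x̄`, `a := cp ≫ Spec h`,
  -- `a′ := t′ := cp ≫ Spec h′`, `hpt := hspt`, `e := et`; `cp : Spec κ̄ → Spec R` the geometric closed point of `R`): `ū := E_𝒜 ≫ U_{t′} ≫ E_𝒞⁻¹`, written literally
  refine ⟨((𝒜.fibreBaseChangeIso (pullback.fst 𝓨.total.hom (specResidueField v)) (𝓨.geomReductionMap x).left ≪≫ 𝒜.fibreCongrPtIso hspt ≪≫ (𝒜.fibreBaseChangeIso z.left (((geomClosedPointIsoSpecResidueField v).inv.left ≫ (specRingHomι (closureValuationSubring (v.adicCompletion K)) (toClosureValuationSubring v) (IsLocalRing.residue (closureValuationSubring (v.adicCompletion K)))).left) ≫ Spec.map (CommRingCat.ofHom h))).symm ≪≫ ((𝒜.baseChange z.left).fibreCongrPtIso et).symm ≪≫ ((𝒜.baseChange z.left).fibreBaseChangeIso (Spec.map (CommRingCat.ofHom (algebraMap D (integralClosure D L')))) (((geomClosedPointIsoSpecResidueField v).inv.left ≫ (specRingHomι (closureValuationSubring (v.adicCompletion K))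 (toClosureValuationSubring v) (IsLocalRing.residue (closureValuationSubring (v.adicCompletion K)))).left) ≫ Spec.map (CommRingCat.ofHom h'))).symm).hom ≫ fibreHom U (((geomClosedPointIsoSpecResidueField v).inv.left ≫ (specRingHomι (closureValuationSubring (v.adicCompletion K)) (toClosureValuationSubring v) (IsLocalRing.residue (closureValuationSubring (v.adicCompletion K)))).left) ≫ Spec.map (CommRingCat.ofHom h')) ≫ (𝒞.fibreBaseChangeIso (pullback.fst 𝓨.total.hom (specResidueField v)) (𝓨.geomReductionMap x'').left ≪≫ 𝒞.fibreCongrPtIso hspt'' ≪≫ (𝒞.fibreBaseChangeIso z''.left (((geomClosedPointIsoSpecResidueField v).inv.left ≫ (specRingHomι (closureValuationSubring (v.adicCompletion K)) (toClosureValuationSubring v) (IsLocalRing.residue (closureValuationSubring (v.adicCompletion K)))).left) ≫ Spec.map (CommRingCat.ofHom h))).symm ≪≫ ((𝒞.baseChange z''.left).fibreCongrPtIso et).symm ≪≫ ((𝒞.baseChange z''.left).fibreBaseChangeIso (Spec.map (CommRingCat.ofHom (algebraMap D (integralClosure D L')))) (((geomClosedPointIsoSpecResidueField v).inv.left ≫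 (specRingHomι (closureValuationSubring (v.adicCompletion K)) (toClosureValuationSubring v) (IsLocalRing.residue (closureValuationSubring (v.adicCompletion K)))).left) ≫ Spec.map (CommRingCat.ofHom h'))).symm).inv).hom.hom.hom,
    ((𝒜.fibreBaseChangeIso (pullback.fst 𝓨.total.hom (specResidueField v)) (𝓨.geomReductionMap x).left ≪≫ 𝒜.fibreCongrPtIso hspt ≪≫ (𝒜.fibreBaseChangeIso z.left (((geomClosedPointIsoSpecResidueField v).inv.left ≫ (specRingHomι (closureValuationSubring (v.adicCompletion K)) (toClosureValuationSubring v) (IsLocalRing.residue (closureValuationSubring (v.adicCompletion K)))).left) ≫ Spec.map (CommRingCat.ofHom h))).symm ≪≫ ((𝒜.baseChange z.left).fibreCongrPtIso et).symm ≪≫ ((𝒜.baseChange z.left).fibreBaseChangeIso (Spec.map (CommRingCat.ofHom (algebraMap D (integralClosure D L')))) (((geomClosedPointIsoSpecResidueField v).inv.left ≫ (specRingHomι (closureValuationSubring (v.adicCompletion K)) (toClosureValuationSubring v) (IsLocalRing.residue (closureValuationSubring (v.adicCompletion K)))).left) ≫ Spec.map (CommRingCat.ofHom h'))).symm).hom ≫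 fibreHom U (((geomClosedPointIsoSpecResidueField v).inv.left ≫ (specRingHomι (closureValuationSubring (v.adicCompletion K)) (toClosureValuationSubring v) (IsLocalRing.residue (closureValuationSubring (v.adicCompletion K)))).left) ≫ Spec.map (CommRingCat.ofHom h')) ≫ (𝒞.fibreBaseChangeIso (pullback.fst 𝓨.total.hom (specResidueField v)) (𝓨.geomReductionMap x'').left ≪≫ 𝒞.fibreCongrPtIso hspt'' ≪≫ (𝒞.fibreBaseChangeIso z''.left (((geomClosedPointIsoSpecResidueField v).inv.left ≫ (specRingHomι (closureValuationSubring (v.adicCompletion K)) (toClosureValuationSubring v) (IsLocalRing.residue (closureValuationSubring (v.adicCompletion K)))).left) ≫ Spec.map (CommRingCat.ofHom h))).symm ≪≫ ((𝒞.baseChange z''.left).fibreCongrPtIso et).symm ≪≫ ((𝒞.baseChange z''.left).fibreBaseChangeIso (Spec.map (CommRingCat.ofHom (algebraMap D (integralClosure D L')))) (((geomClosedPointIsoSpecResidueField v).inv.left ≫ (specRingHomι (closureValuationSubring (v.adicCompletion K)) (toClosureValuationSubring v) (IsLocalRing.residue (closureValuationSubring (v.adicCompletion K)))).left) ≫ Spec.map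 (CommRingCat.ofHom h'))).symm).inv).hom.hom.isMonHom_hom, ?_, ?_, ?_, ?_⟩
  · -- (v) an isomorphism reduces to an isomorphism (§1 `isIso_specialFibre_of_isIso`: `deg U` is constant along the Dedekind stage and `deg u = 1`)
    haveI : IsIso (AbelianVariety.Hom.toSchemeHom (homOfIsMonHom u)) := inferInstanceAs (IsIso ((Over.forget _).map u))
    have hu : AbelianVariety.IsIsogeny (homOfIsMonHom u) := ⟨inferInstance, inferInstance⟩
    exact isIso_specialFibre_of_isIso L' (𝓨.genericIso'.inv.left ≫ pullback.fst 𝓨.total.hom (specGenericPoint (valuationSubringAtPrime K v) K)) z.left z''.left (Spec.map (CommRingCat.ofHom (algebraMap D (integralClosure D L')))) x.left x''.left (specGenericPoint (closureValuationSubring (v.adicCompletion K)) (AlgebraicClosure (v.adicCompletion K)) ≫ Spec.map (CommRingCat.ofHom h)) (specGenericPoint (closureValuationSubring (v.adicCompletion K)) (AlgebraicClosure (v.adicCompletion K)) ≫ Spec.map (CommRingCat.ofHom h')) hpt hpt'' e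
      (pullback.fst 𝓨.total.hom (specResidueField v)) (𝓨.geomReductionMap x).left (𝓨.geomReductionMap x'').left (((geomClosedPointIsoSpecResidueField v).inv.left ≫ (specRingHomι (closureValuationSubring (v.adicCompletion K)) (toClosureValuationSubring v) (IsLocalRing.residue (closureValuationSubring (v.adicCompletion K)))).left) ≫ Spec.map (CommRingCat.ofHom h)) (((geomClosedPointIsoSpecResidueField v).inv.left ≫ (specRingHomι (closureValuationSubring (v.adicCompletion K)) (toClosureValuationSubring v) (IsLocalRing.residue (closureValuationSubring (v.adicCompletion K)))).left) ≫ Spec.map (CommRingCat.ofHom h')) hspt hspt'' et 𝒜 𝒞 U u hfib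
      (hisog hu (specGenericPoint (integralClosure D L') L'))
  · -- (ii) equivariance transfers (§1 `baseChangeHom_comp_specialFibre_eq_of_generic` at the turnkey's two stages)
    intro f g hf hg hfg
    exact baseChangeHom_comp_specialFibre_eq_of_generic (𝓨.genericIso'.inv.left ≫ pullback.fst 𝓨.total.hom (specGenericPoint (valuationSubringAtPrime K v) K)) z.left z''.left (Spec.map (CommRingCat.ofHom (algebraMap D (integralClosure D L')))) x.left x''.left (specGenericPoint (closureValuationSubring (v.adicCompletion K)) (AlgebraicClosure (v.adicCompletion K)) ≫ Spec.map (CommRingCat.ofHom h)) (specGenericPoint (closureValuationSubring (v.adicCompletion K)) (AlgebraicClosure (v.adicCompletion K)) ≫ Spec.map (CommRingCat.ofHom h')) hpt hpt'' e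
      (pullback.fst 𝓨.total.hom (specResidueField v)) (𝓨.geomReductionMap x).left (𝓨.geomReductionMap x'').left (((geomClosedPointIsoSpecResidueField v).inv.left ≫ (specRingHomι (closureValuationSubring (v.adicCompletion K)) (toClosureValuationSubring v) (IsLocalRing.residue (closureValuationSubring (v.adicCompletion K)))).left) ≫ Spec.map (CommRingCat.ofHom h)) (((geomClosedPointIsoSpecResidueField v).inv.left ≫ (specRingHomι (closureValuationSubring (v.adicCompletion K)) (toClosureValuationSubring v) (IsLocalRing.residue (closureValuationSubring (v.adicCompletion K)))).left) ≫ Spec.map (CommRingCat.ofHom h')) hspt hspt'' et 𝒜 𝒞 U u hfib f g hfg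
  · -- (iii) section values transfer (§1 `map_specialFibre_restrictPt_eq_of_generic`)
    intro τ τ'' hτ
    exact map_specialFibre_restrictPt_eq_of_generic (𝓨.genericIso'.inv.left ≫ pullback.fst 𝓨.total.hom (specGenericPoint (valuationSubringAtPrime K v) K)) z.left z''.left (Spec.map (CommRingCat.ofHom (algebraMap D (integralClosure D L')))) x.left x''.left (specGenericPoint (closureValuationSubring (v.adicCompletion K)) (AlgebraicClosure (v.adicCompletion K)) ≫ Spec.map (CommRingCat.ofHom h)) (specGenericPoint (closureValuationSubring (v.adicCompletion K)) (AlgebraicClosure (v.adicCompletion K)) ≫ Spec.map (CommRingCat.ofHom h')) hpt hpt'' e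
      (pullback.fst 𝓨.total.hom (specResidueField v)) (𝓨.geomReductionMap x).left (𝓨.geomReductionMap x'').left (((geomClosedPointIsoSpecResidueField v).inv.left ≫ (specRingHomι (closureValuationSubring (v.adicCompletion K)) (toClosureValuationSubring v) (IsLocalRing.residue (closureValuationSubring (v.adicCompletion K)))).left) ≫ Spec.map (CommRingCat.ofHom h)) (((geomClosedPointIsoSpecResidueField v).inv.left ≫ (specRingHomι (closureValuationSubring (v.adicCompletion K)) (toClosureValuationSubring v) (IsLocalRing.residue (closureValuationSubring (v.adicCompletion K)))).left) ≫ Spec.map (CommRingCat.ofHom h')) hspt hspt'' et 𝒜 𝒞 U u hfib τ τ'' hτ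
  · -- (iv) the polarisation law transfers (§1 `specialFibre_comp_lam_comp_dualIsogenyOver_eq_of_generic`; the refined stage `Spec D′` is connected, reduced, Noetherian)
    intro D𝒜 pol𝒜 D𝒞 pol𝒞 n hlam
    haveI : IsNoetherianRing (integralClosure D L') := inferInstance
    exact specialFibre_comp_lam_comp_dualIsogenyOver_eq_of_generic (𝓨.genericIso'.inv.left ≫ pullback.fst 𝓨.total.hom (specGenericPoint (valuationSubringAtPrime K v) K)) z.left z''.left (Spec.map (CommRingCat.ofHom (algebraMap D (integralClosure D L')))) x.left x''.left (specGenericPoint (closureValuationSubring (v.adicCompletion K)) (AlgebraicClosure (v.adicCompletion K)) ≫ Spec.map (CommRingCat.ofHom h)) (specGenericPoint (closureValuationSubring (v.adicCompletion K)) (AlgebraicClosure (v.adicCompletion K)) ≫ Spec.map (CommRingCat.ofHom h')) hpt hpt'' e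
      (pullback.fst 𝓨.total.hom (specResidueField v)) (𝓨.geomReductionMap x).left (𝓨.geomReductionMap x'').left (((geomClosedPointIsoSpecResidueField v).inv.left ≫ (specRingHomι (closureValuationSubring (v.adicCompletion K)) (toClosureValuationSubring v) (IsLocalRing.residue (closureValuationSubring (v.adicCompletion K)))).left) ≫ Spec.map (CommRingCat.ofHom h)) (((geomClosedPointIsoSpecResidueField v).inv.left ≫ (specRingHomι (closureValuationSubring (v.adicCompletion K)) (toClosureValuationSubring v) (IsLocalRing.residue (closureValuationSubring (v.adicCompletion K)))).left) ≫ Spec.map (CommRingCat.ofHom h')) hspt hspt'' et 𝒜 𝒞 U u hfib D𝒜 pol𝒜 D𝒞 pol𝒞 n hlam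

end Head

end AbelianSchemeOver

end Literature.AlgebraicGeometry.AbelianSchemes

end
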